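import Literature.Probability.RandomPlanarGeometry.SAWCount
import Mathlib.Data.Fin.VecNotation
import HarnessLib

/-!
# Self-avoiding walks on `ℤ²` as step words

Topic `Literature/Probability/RandomPlanarGeometry` (continues `SAWCount.lean`). A nearest-neighbour
walk on `ℤ²` from the origin is recorded by its **step word** `w : List Step`, `Step = Fin 4`
(`0 ↦ +e₀`, `1 ↦ +e₁`, `2 ↦ -e₀`, `3 ↦ -e₁`). This is the executable model used by the certified
computations bounding the connective constant (`SAWFiniteMemory.lean`, finite-memory automata;
the strip transfer matrices of the lower bound): everything here is computable and decidable.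

## Contents (namespace `Literature.Probability.RandomPlanarGeometry.SAW`)

* `Step`, `Step.vec d : Site 2` (the unit step), `Step.dx`, `Step.dy` (its coordinates);
* `wEnd w` (endpoint of the word `w` started at `0`), `traj w : ℕ → Site 2` (position after `i`
  steps, frozen after `|w|` — the vertex function of `SAWCount.lean`), `IsSAW w` (decidable);
* `words n` (all `4ⁿ` words of length `n`), `sawWords n` (the self-avoiding ones);
* `traj_mem_saws`, `traj_injOn`, `image_traj_sawWords` and
  **`card_sawWords : #(sawWords n) = cₙ`** (`= Zd.count 2 n = SAW.count n`): step words and the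
  vertex functions `Zd.saws 2 n` are in bijection (Madras–Slade 1993, §1.1: a walk is the sequence
  of its nearest-neighbour steps).

## References

* N. Madras, G. Slade, *The Self-Avoiding Walk*, Birkhäuser (1993), §1.1.
-/

open Finset Literature.Probability.LatticeModels SimpleGraph
open scoped BigOperators

namespace Literature.Probability.RandomPlanarGeometry.SAW

/-! ### Directions and steps -/

/-- The four lattice directions of `ℤ²`: `0 ↦ +e₀`, `1 ↦ +e₁`, `2 ↦ -e₀`, `3 ↦ -e₁`. [folklore] -/
abbrev Step : Type := Fin 4

namespace Step

/-- First coordinate of the unit step in direction `d`. [folklore] -/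
def dx (d : Step) : ℤ := if d = 0 then 1 else if d = 2 then -1 else 0

/-- Second coordinate of the unit step in direction `d`. [folklore] -/
def dy (d : Step) : ℤ := if d = 1 then 1 else if d = 3 then -1 else 0

/-- The unit step `vec d ∈ {±e₀, ±e₁}` of `ℤ²` in direction `d`. [folklore] -/
def vec (d : Step) : Site 2 := ![dx d, dy d]

/-- Coordinate `0` of `vec d`. [folklore] -/
@[simp] theorem vec_apply_zero (d : Step) : vec d 0 = dx d := rfl

/-- Coordinate `1` of `vec d`. [folklore] -/
@[simp] theorem vec_apply_one (d : Step) : vec d 1 = dy d := rfl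

/-- The four unit steps, as `± Pi.single j 1`. [folklore] -/
theorem vec_eq (d : Step) :
    vec d = Pi.single 0 1 ∨ vec d = Pi.single 1 1 ∨ vec d = -Pi.single 0 1 ∨
      vec d = -Pi.single 1 1 := by
  fin_cases d
  · left; funext j; fin_cases j <;> simp [vec, dx, dy]
  · right; left; funext j; fin_cases j <;> simp [vec, dx, dy]
  · right; right; left; funext j; fin_cases j <;> simp [vec, dx, dy]
  · right; right; right; funext j; fin_cases j <;> simp [vec, dx, dy]

/-- `vec` is injective. [folklore] -/
theorem vec_injective : Function.Injective vec := by
  unfold Function.Injective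
  decide

/-- A step is an edge of the nearest-neighbour graph: `x ∼ x + vec d`. [folklore] -/
theorem adj_add_vec (x : Site 2) (d : Step) : (zdGraph 2).Adj x (x + vec d) := by
  rw [zdGraph_adj_iff]
  rcases vec_eq d with h | h | h | h
  · exact ⟨0, Or.inl (by rw [h])⟩
  · exact ⟨1, Or.inl (by rw [h])⟩
  · exact ⟨0, Or.inr (by rw [h]; simp)⟩
  · exact ⟨1, Or.inr (by rw [h]; simp)⟩

/-- The direction of the step from `x` to an adjacent `y` (junk `3` if not adjacent). [folklore] -/
def ofStep (x y : Site 2) : Step :=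
  if y = x + vec 0 then 0 else if y = x + vec 1 then 1 else if y = x + vec 2 then 2 else 3

/-- For adjacent sites, `y = x + vec (ofStep x y)`. [folklore] -/
theorem eq_add_vec_ofStep {x y : Site 2} (h : (zdGraph 2).Adj x y) : y = x + vec (ofStep x y) := by
  have key : ∃ d, y = x + vec d := by
    obtain ⟨i, hi | hi⟩ := (zdGraph_adj_iff x y).1 h
    · fin_cases i
      · exact ⟨0, by rw [hi]; congr 1; funext j; fin_cases j <;> simp [vec, dx, dy]⟩
      · exact ⟨1, by rw [hi]; congr 1; funext j; fin_cases j <;> simp [vec, dx, dy]⟩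
    · fin_cases i
      · exact ⟨2, by rw [hi]; funext j; fin_cases j <;> simp [vec, dx, dy]⟩
      · exact ⟨3, by rw [hi]; funext j; fin_cases j <;> simp [vec, dx, dy]⟩
  obtain ⟨d, hd⟩ := key
  unfold ofStep
  split_ifs with h0 h1 h2
  · exact h0
  · exact h1
  · exact h2
  · fin_cases d
    · exact absurd hd h0
    · exact absurd hd h1
    · exact absurd hd h2
    · exact hd

end Step

/-! ### Words, endpoints, trajectories -/

/-- Endpoint of the walk with step word `w` started at the origin. [folklore] -/
def wEnd (w : List Step) : Site 2 := (w.map Step.vec).sum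

/-- `wEnd [] = 0`. [folklore] -/
@[simp] theorem wEnd_nil : wEnd [] = 0 := rfl

/-- `wEnd (w ++ w') = wEnd w + wEnd w'`. [folklore] -/
@[simp] theorem wEnd_append (w w' : List Step) : wEnd (w ++ w') = wEnd w + wEnd w' := by
  simp [wEnd, List.sum_append]

/-- `wEnd [d] = vec d`. [folklore] -/
@[simp] theorem wEnd_singleton (d : Step) : wEnd [d] = Step.vec d := by simp [wEnd]

/-- `wEnd (d :: w) = vec d + wEnd w`. [folklore] -/
@[simp] theorem wEnd_cons (d : Step) (w : List Step) : wEnd (d :: w) = Step.vec d + wEnd w := by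
  simp [wEnd]

/-- The vertex function of the word `w`: position after `i` steps, frozen at the endpoint for
`i ≥ |w|` (the model of `SAWCount.lean`). [cite: MadrasSlade1993, §1.1] -/
def traj (w : List Step) (i : ℕ) : Site 2 := wEnd (w.take i)

/-- The walk starts at the origin. [folklore] -/
@[simp] theorem traj_zero (w : List Step) : traj w 0 = 0 := by simp [traj]

/-- One step of the walk: `traj w (i+1) = traj w i + vec w[i]`. [folklore] -/
theorem traj_succ (w : List Step) {i : ℕ} (hi : i < w.length) :
    traj w (i + 1) = traj w i + Step.vec (w[i]) := by
  rw [traj, traj, List.take_succ_eq_append_getElem hi, wEnd_append, wEnd_singleton]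

/-- The walk is frozen from time `|w|` on. [folklore] -/
theorem traj_of_le (w : List Step) {i : ℕ} (hi : w.length ≤ i) : traj w i = wEnd w := by
  simp [traj, List.take_of_length_le hi]

/-- At time `|w|` the walk is at its endpoint. [folklore] -/
@[simp] theorem traj_length (w : List Step) : traj w w.length = wEnd w := traj_of_le w le_rfl

/-- The trajectory of a prefix agrees with the original up to its length. [folklore] -/
theorem traj_take (w : List Step) {i k : ℕ} (hik : i ≤ k) : traj (w.take k) i = traj w i := by
  simp [traj, List.take_take, min_eq_left hik]

/-- The trajectory of `w ++ w'` up to time `|w|` is that of `w`. [folklore] -/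
theorem traj_append_left (w w' : List Step) {i : ℕ} (hi : i ≤ w.length) :
    traj (w ++ w') i = traj w i := by
  simp [traj, List.take_append_of_le_length hi]

/-- The trajectory of `w ++ w'` after time `|w|` is the translate of that of `w'`. [folklore] -/
theorem traj_append_right (w w' : List Step) (i : ℕ) :
    traj (w ++ w') (w.length + i) = wEnd w + traj w' i := by
  simp [traj, List.take_append, List.take_of_length_le (Nat.le_add_right w.length i)]

/-- Consecutive positions are adjacent. [folklore] -/
theorem adj_traj_succ (w : List Step) {i : ℕ} (hi : i < w.length) :
    (zdGraph 2).Adj (traj w i) (traj w (i + 1)) := by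
  rw [traj_succ w hi]
  exact Step.adj_add_vec _ _

/-! ### Self-avoiding words -/

/-- The list of the `|w| + 1` vertices visited by `w`. [folklore] -/
def verts (w : List Step) : List (Site 2) := (List.range (w.length + 1)).map (traj w)

/-- **Self-avoiding word**: the `|w| + 1` visited vertices are distinct. Decidable.
[cite: MadrasSlade1993, Definition 1.1.1] -/
def IsSAW (w : List Step) : Prop := (verts w).Nodup

/-- Self-avoidance of a word is decidable. [folklore] -/
instance (w : List Step) : Decidable (IsSAW w) := inferInstanceAs (Decidable (verts w).Nodup)

/-- Self-avoidance as injectivity of the trajectory on `[0, |w|]`. [folklore] -/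
theorem isSAW_iff_injOn (w : List Step) : IsSAW w ↔ Set.InjOn (traj w) {i | i ≤ w.length} := by
  rw [IsSAW, verts, List.nodup_map_iff_inj_on List.nodup_range]
  constructor
  · intro h i hi j hj hij
    exact h i (List.mem_range.2 (Nat.lt_succ_of_le hi)) j (List.mem_range.2 (Nat.lt_succ_of_le hj)) hij
  · intro h i hi j hj hij
    exact h (Nat.le_of_lt_succ (List.mem_range.1 hi)) (Nat.le_of_lt_succ (List.mem_range.1 hj)) hij

/-- The empty word is self-avoiding. [folklore] -/
theorem isSAW_nil : IsSAW [] := by decide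

/-- A prefix of a self-avoiding word is self-avoiding. [folklore] -/
theorem IsSAW.take {w : List Step} (h : IsSAW w) (k : ℕ) : IsSAW (w.take k) := by
  rw [isSAW_iff_injOn] at h ⊢
  intro i hi j hj hij
  simp only [Set.mem_setOf_eq, List.length_take] at hi hj
  have hi' : i ≤ k := le_trans hi (min_le_left _ _)
  have hj' : j ≤ k := le_trans hj (min_le_left _ _)
  rw [traj_take w hi', traj_take w hj'] at hij
  exact h (le_trans hi (min_le_right _ _)) (le_trans hj (min_le_right _ _)) hij

/-- A suffix of a self-avoiding word is self-avoiding (translation invariance). [folklore] -/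
theorem IsSAW.drop {w : List Step} (h : IsSAW w) (k : ℕ) : IsSAW (w.drop k) := by
  rcases le_or_gt k w.length with hk | hk
  · rw [isSAW_iff_injOn] at h ⊢
    intro i hi j hj hij
    simp only [Set.mem_setOf_eq, List.length_drop] at hi hj
    have hlen : (w.take k).length = k := by simp [min_eq_left hk]
    have key : ∀ m, traj w (k + m) = wEnd (w.take k) + traj (w.drop k) m := fun m => by
      have := traj_append_right (w.take k) (w.drop k) m
      rwa [List.take_append_drop, hlen] at this
    have := h (show k + i ≤ w.length by omega) (show k + j ≤ w.length by omega)
      (by rw [key, key, hij])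
    omega
  · rw [List.drop_of_length_le hk.le]
    exact isSAW_nil

/-! ### The finite sets of words -/

/-- All `4ⁿ` step words of length `n`. [folklore] -/
def words (n : ℕ) : Finset (List Step) :=
  (Finset.univ : Finset (Fin n → Step)).image List.ofFn

/-- Membership in `words n` is having length `n`. [folklore] -/
@[simp] theorem mem_words {n : ℕ} {w : List Step} : w ∈ words n ↔ w.length = n := by
  simp only [words, Finset.mem_image, Finset.mem_univ, true_and]
  constructor
  · rintro ⟨f, rfl⟩; simp
  · intro h; subst h; exact ⟨fun i => w[i], List.ofFn_getElem⟩

/-- `#(words n) = 4ⁿ`. [folklore] -/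
theorem card_words (n : ℕ) : (words n).card = 4 ^ n := by
  rw [words, Finset.card_image_of_injective _ List.ofFn_injective]
  simp

/-- The self-avoiding words of length `n`. [cite: MadrasSlade1993, Definition 1.1.1] -/
def sawWords (n : ℕ) : Finset (List Step) := (words n).filter IsSAW

/-- Membership in `sawWords n`. [folklore] -/
@[simp] theorem mem_sawWords {n : ℕ} {w : List Step} : w ∈ sawWords n ↔ w.length = n ∧ IsSAW w := by
  simp [sawWords]

/-! ### The bijection with the vertex functions `Zd.saws 2 n` -/

/-- The trajectory of a self-avoiding word of length `n` is an element of `Zd.saws 2 n`.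
[cite: MadrasSlade1993, §1.1] -/
theorem traj_mem_saws {n : ℕ} {w : List Step} (hl : w.length = n) (hs : IsSAW w) :
    traj w ∈ Zd.saws 2 n := by
  subst hl
  refine Zd.mem_saws.2 ⟨traj_zero w, fun i hi => ?_, fun i hi => adj_traj_succ w hi, ?_⟩
  · rw [traj_of_le w hi, traj_length]
  · exact (isSAW_iff_injOn w).1 hs

/-- Words of equal length with the same trajectory are equal. [folklore] -/
theorem eq_of_traj_eq {w w' : List Step} (hl : w.length = w'.length) (h : traj w = traj w') :
    w = w' := by
  refine List.ext_getElem hl fun i hi hi' => ?_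
  have h1 := traj_succ w hi
  have h2 := traj_succ w' hi'
  rw [congrFun h i, congrFun h (i + 1), h2, add_right_inj] at h1
  exact Step.vec_injective h1.symm

/-- `traj` is injective on the words of length `n`. [folklore] -/
theorem traj_injOn (n : ℕ) : Set.InjOn traj (words n : Set (List Step)) := by
  intro w hw w' hw' h
  rw [Finset.mem_coe, mem_words] at hw hw'
  exact eq_of_traj_eq (hw.trans hw'.symm) h

/-- The step word read off a vertex function `ω : ℕ → ℤ²` (first `n` steps). [folklore] -/
def wordOf (n : ℕ) (ω : ℕ → Site 2) : List Step := List.ofFn fun i : Fin n => Step.ofStep (ω i) (ω (i + 1))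

/-- `wordOf n ω` has length `n`. [folklore] -/
@[simp] theorem length_wordOf (n : ℕ) (ω : ℕ → Site 2) : (wordOf n ω).length = n := by
  simp [wordOf]

/-- The trajectory of the word read off `ω ∈ Zd.saws 2 n` is `ω`. [folklore] -/
theorem traj_wordOf {n : ℕ} {ω : ℕ → Site 2} (hω : ω ∈ Zd.saws 2 n) : traj (wordOf n ω) = ω := by
  obtain ⟨h0, hend, hadj, -⟩ := Zd.mem_saws.1 hω
  have key : ∀ i ≤ n, traj (wordOf n ω) i = ω i := by
    intro i
    induction i with
    | zero => intro; simp [h0]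
    | succ i ih =>
      intro hi
      have hi' : i < (wordOf n ω).length := by simp; omega
      rw [traj_succ _ hi', ih (by omega)]
      have : (wordOf n ω)[i] = Step.ofStep (ω i) (ω (i + 1)) := by simp [wordOf]
      rw [this]
      exact (Step.eq_add_vec_ofStep (hadj i (by omega))).symm
  funext i
  rcases le_or_gt i n with hi | hi
  · exact key i hi
  · rw [traj_of_le _ (by simp; omega), ← traj_length, length_wordOf, key n le_rfl, hend i hi.le]

open Classical in
/-- The image of the self-avoiding words of length `n` under `traj` is `Zd.saws 2 n`.
[cite: MadrasSlade1993, §1.1] -/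
theorem image_traj_sawWords (n : ℕ) : (sawWords n).image traj = Zd.saws 2 n := by
  ext ω
  simp only [Finset.mem_image, mem_sawWords]
  constructor
  · rintro ⟨w, ⟨hl, hs⟩, rfl⟩
    exact traj_mem_saws hl hs
  · intro hω
    refine ⟨wordOf n ω, ⟨length_wordOf n ω, ?_⟩, traj_wordOf hω⟩
    rw [isSAW_iff_injOn, traj_wordOf hω, length_wordOf]
    exact (Zd.mem_saws.1 hω).2.2.2

open Classical in
/-- **`#(sawWords n) = cₙ`**: self-avoiding step words of length `n` are in bijection with the
`n`-step self-avoiding walks from the origin. [cite: MadrasSlade1993, §1.1] -/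
theorem card_sawWords (n : ℕ) : (sawWords n).card = Zd.count 2 n := by
  rw [← Zd.card_saws, ← image_traj_sawWords, Finset.card_image_of_injOn]
  intro w hw w' hw' h
  exact traj_injOn n (by simp [(mem_sawWords.1 hw).1]) (by simp [(mem_sawWords.1 hw').1]) h

/-- The planar count `SAW.count n` is the number of self-avoiding step words of length `n`.
[cite: MadrasSlade1993, §1.1] -/
theorem count_eq_card_sawWords (n : ℕ) : count n = (sawWords n).card := by
  rw [card_sawWords, Zd.count_two]

/-- `sawWords (n+1)` injects into `sawWords n × Step` by splitting off the last step; in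
particular every word of `sawWords (n + 1)` is `w ++ [d]` with `w ∈ sawWords n`. [folklore] -/
theorem mem_sawWords_succ {n : ℕ} {w : List Step} (h : w ∈ sawWords (n + 1)) :
    ∃ w' ∈ sawWords n, ∃ d : Step, w = w' ++ [d] := by
  obtain ⟨hl, hs⟩ := mem_sawWords.1 h
  refine ⟨w.take n, mem_sawWords.2 ⟨by simp [hl], hs.take n⟩, w[n]'(by omega), ?_⟩
  conv_lhs => rw [← List.take_append_drop n w]
  rw [List.drop_eq_getElem_cons (by omega), List.drop_of_length_le (by omega)]

end Literature.Probability.RandomPlanarGeometry.SAW
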